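import Summits.ValiantsHypothesis.ValiantsHypothesis.Theses.ValuativeGCT
import Literature.Computability.AlgebraicComplexity.MultiplicityObstructionsProofs
import Literature.NumberTheory.DiophantineGeometry.SchurWeylPlethysmRenameProofs

/-!
# `ValuativeGCT.GctMultPrinciple` (stmt-ValiantsHypothesis-0889) — the multiplicity-obstruction principle, weight form

`GctMultPrinciple_proof : Theses.ValuativeGCT.GctMultPrinciple`: for `n ≤ m` and a highest weight `χ` of `GL_{m²}`
(lexicographic Borel on `MatIdx m`) with `mult_χ ℂ[Δ(det_m)] < mult_χ ℂ[Δ(X₀₀^{m-n} per_n)]`, the padded permanent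
`X₀₀^{m-n} per_n` does not lie in `Δ(det_m) = \overline{GL_{m²} · det_m}` (Mulmuley–Sohoni 2008; BLMW 2011 §1 and
Prop. 3.3.2; Bürgisser–Ikenmeyer–Panova 2019 §1.1; Bläser–Ikenmeyer 2025 §12.4).

Proof: the conclusion is literally `¬ HasBorderDetRepr ℂ n m` (`OrbitClosure.lean`), and
`not_hasBorderDetRepr_of_orbitMultiplicity_lt` (`MultiplicityObstructions.lean`) derives it from the two named facts
`orbitMultiplicity_le_of_mem_orbitClosure` (equivariant surjection `ℂ[Δ det_m] ↠ ℂ[Δ pp]` of degreewise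
finite-dimensional completely reducible `GL`-representations, so highest-weight spaces surject) and
`hasBorderDetRepr_iff_rename` (transport of orbit-closure membership to the lexicographically ordered variables),
both DISCHARGED in tree (`orbitMultiplicity_le_of_mem_orbitClosure_holds`, `MultiplicityObstructionsProofs.lean`;
`hasBorderDetRepr_iff_rename_holds`, `SchurWeylPlethysmRenameProofs.lean`). The theorem is therefore unconditional.
The item is shared verbatim with route GCTMult (`Theses.GCTMult.GctMultPrinciple`, same statement).
-/

namespace Summit.ValiantsHypothesis.ValiantsHypothesis.Theorems

-- `Summit.ValiantsHypothesis.ValiantsHypothesis.…` is the tree's mandated single-conjunct layout (Sub = Summit).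
set_option linter.dupNamespace false

/-- **Multiplicity-obstruction principle, weight form** — settles `stmt-ValiantsHypothesis-0889`
(`Theses.ValuativeGCT.GctMultPrinciple`): if some highest weight `χ` has strictly larger multiplicity in
`ℂ[Δ(X₀₀^{m-n} per_n)]` than in `ℂ[Δ(det_m)]` (`n ≤ m`), then `X₀₀^{m-n} per_n ∉ Δ(det_m)`. One line over the
discharged tree facts `orbitMultiplicity_le_of_mem_orbitClosure_holds` and `hasBorderDetRepr_iff_rename_holds` via
`not_hasBorderDetRepr_of_orbitMultiplicity_lt`. Mulmuley–Sohoni 2008 §1–3; BLMW 2011 §1; BIP 2019 §1.1;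
Bläser–Ikenmeyer 2025 §12.4. [cite: BlaeserIkenmeyer2025, §12.4] -/
theorem GctMultPrinciple_proof : Theses.ValuativeGCT.GctMultPrinciple := by
  unfold Theses.ValuativeGCT.GctMultPrinciple
  intro n m _ χ hnm hlt
  exact Literature.Computability.AlgebraicComplexity.not_hasBorderDetRepr_of_orbitMultiplicity_lt
    Literature.Computability.AlgebraicComplexity.orbitMultiplicity_le_of_mem_orbitClosure_holds
    Literature.NumberTheory.DiophantineGeometry.hasBorderDetRepr_iff_rename_holds hnm hlt

end Summit.ValiantsHypothesis.ValiantsHypothesis.Theorems
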